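import Mathlib
import Summits.ValiantsHypothesis.ValiantsHypothesis.Theorems.ValuativeGCTValuativeFlipGradedBottomRank
import Summits.ValiantsHypothesis.ValiantsHypothesis.Theorems.ValuativeGCTValuativeFlipSlidingWindows
import Summits.ValiantsHypothesis.ValiantsHypothesis.Theorems.ValuativeGCTValuativeFlipStrataRankR
import Summits.ValiantsHypothesis.ValiantsHypothesis.Theorems.ValuativeGCTValuativeFlipStrataRankL
import Summits.ValiantsHypothesis.ValiantsHypothesis.Theorems.ValuativeGCTValuativeFlipCyclicContinuant

/-!
# The explicit configuration and the bottoms of the pure products (crux `ValuativeGCT.ValuativeFlip`, stub `stub_fourRowPencilRank`)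

P3 of the cyclic-tridiagonal architecture for hypothesis `H` of
`fourRowPencilRank_of_pencilCertificate` (`Cruxes/ValuativeFlip/AxisK9G1a2CyclicTridiagonal.md` §4).
The EXPLICIT CONFIGURATION of linear forms in `y₀, …, y₃` attached to `α γ : ZMod n → K`:

  loops `exL γ r = y₂ - γ_r y₃`, clockwise forms `exM α r = y₀ - α_r y₁`,
  counter-clockwise forms `exM' α r = exM α (r+1)`.

Grade by the weight `bw = (1,1,0,0)` (degree in `y₀, y₁`).  Then `exL` has weight `0`, `exM, exM'`
weight `1`, the weight-`0` component of a continuant is the product of its loops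
(`bw_whc_kont : (kont …) _0 = swW γ 2 3 L a`), and the bottoms (lowest weight components) of the
multiplied pure products are the stratum generators of files `…StrataRankR/L`:

* `genR α γ e (q, o, t) = y_{2+t} · (Tw q e | Sw q e)` (`o = 0 | 1`) has no component of weight `< e`
  and weight-`e` component `srGen α γ e (n-1-e) (q, o, t)` (`bw_whc_genR`, `bw_whc_genR_eq_zero`);
* `genL α γ e (q, o, t) = y_t · (Tw q e | Sw q e)` has no component of weight `< e+1` and
  weight-`(e+1)` component `slGen α γ e (n-1-e) (q, o, t)` (`bw_whc_genL`, `bw_whc_genL_eq_zero`).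

[this crux]
-/

set_option linter.dupNamespace false

namespace Summit.ValiantsHypothesis.ValiantsHypothesis.Theorems.ValuativeFlip

open MvPolynomial
open scoped BigOperators

noncomputable section

section config

variable {K : Type*} [Field K] {n : ℕ}

/-- The weight `(1,1,0,0)`: degree in the clockwise variables `y₀, y₁`. [this crux] -/
def bw : Fin 4 → ℕ := fun t => if (t : ℕ) < 2 then 1 else 0

/-- The loops `l_r = y₂ - γ_r y₃` of the explicit configuration. [this crux] -/
def exL (γ : ZMod n → K) (r : ZMod n) : MvPolynomial (Fin 4) K := X 2 - C (γ r) * X 3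

/-- The clockwise forms `m_r = y₀ - α_r y₁` of the explicit configuration. [this crux] -/
def exM (α : ZMod n → K) (r : ZMod n) : MvPolynomial (Fin 4) K := X 0 - C (α r) * X 1

/-- The counter-clockwise forms `m'_r = m_{r+1}` of the explicit configuration. [this crux] -/
def exM' (α : ZMod n → K) (r : ZMod n) : MvPolynomial (Fin 4) K := exM α (r + 1)

/-- The Right-multiplied pure products `y_{2+t} · Tw q e` (`o = 0`) and `y_{2+t} · Sw q e` (`o = 1`).
[this crux] -/
def genR (α γ : ZMod n → K) (e : ℕ) (i : ZMod n × Fin 2 × Fin 2) : MvPolynomial (Fin 4) K :=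
  srMul i.2.2 * (if i.2.1 = 0 then Tw (exL γ) (exM α) (exM' α) i.1 e
    else Sw (exL γ) (exM α) (exM' α) i.1 e)

/-- The Left-multiplied pure products `y_t · Tw q e` (`o = 0`) and `y_t · Sw q e` (`o = 1`).
[this crux] -/
def genL (α γ : ZMod n → K) (e : ℕ) (i : ZMod n × Fin 2 × Fin 2) : MvPolynomial (Fin 4) K :=
  slMul i.2.2 * (if i.2.1 = 0 then Tw (exL γ) (exM α) (exM' α) i.1 e
    else Sw (exL γ) (exM α) (exM' α) i.1 e)

end config

section bottoms

variable {K : Type*} [Field K] {n : ℕ} (α γ : ZMod n → K)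

/-- `bw 0 = 1`. -/
@[simp] theorem bw_zero : bw 0 = 1 := rfl

/-- `bw 1 = 1`. -/
@[simp] theorem bw_one : bw 1 = 1 := rfl

/-- `bw 2 = 0`. -/
@[simp] theorem bw_two : bw 2 = 0 := rfl

/-- `bw 3 = 0`. -/
@[simp] theorem bw_three : bw 3 = 0 := rfl

/-- `l_r` has weight `0`. -/
theorem bw_exL (r : ZMod n) : IsWeightedHomogeneous bw (exL γ r) 0 := by
  unfold exL
  refine (weightedHomogeneousSubmodule K bw 0).sub_mem ?_ ?_
  · simpa using isWeightedHomogeneous_X K bw (2 : Fin 4)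
  · simpa using (isWeightedHomogeneous_C bw (γ r)).mul (isWeightedHomogeneous_X K bw (3 : Fin 4))

/-- `m_r` has weight `1`. -/
theorem bw_exM (r : ZMod n) : IsWeightedHomogeneous bw (exM α r) 1 := by
  unfold exM
  refine (weightedHomogeneousSubmodule K bw 1).sub_mem ?_ ?_
  · simpa using isWeightedHomogeneous_X K bw (0 : Fin 4)
  · simpa using (isWeightedHomogeneous_C bw (α r)).mul (isWeightedHomogeneous_X K bw (1 : Fin 4))

/-- `m'_r` has weight `1`. -/
theorem bw_exM' (r : ZMod n) : IsWeightedHomogeneous bw (exM' α r) 1 := bw_exM α (r + 1)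

/-- `y_{2+t}` has weight `0`. -/
theorem bw_srMul (t : Fin 2) : IsWeightedHomogeneous bw (srMul t : MvPolynomial (Fin 4) K) 0 := by
  unfold srMul
  split_ifs
  · simpa using isWeightedHomogeneous_X K bw (2 : Fin 4)
  · simpa using isWeightedHomogeneous_X K bw (3 : Fin 4)

/-- `y_t` (`t = 0, 1`) has weight `1`. -/
theorem bw_slMul (t : Fin 2) : IsWeightedHomogeneous bw (slMul t : MvPolynomial (Fin 4) K) 1 := by
  unfold slMul
  split_ifs
  · simpa using isWeightedHomogeneous_X K bw (0 : Fin 4)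
  · simpa using isWeightedHomogeneous_X K bw (1 : Fin 4)

/-- A string of `e` forms of weight `1` has weight `e`. -/
theorem bw_cstr {m : ZMod n → MvPolynomial (Fin 4) K} (hm : ∀ r, IsWeightedHomogeneous bw (m r) 1)
    (a : ZMod n) (e : ℕ) : IsWeightedHomogeneous bw (cstr m a e) e := by
  unfold cstr
  have := IsWeightedHomogeneous.prod (Finset.range e) (fun s : ℕ => m (a + (s : ZMod n)))
    (fun _ => (1 : ℕ)) (w := bw) (fun s _ => hm _)
  simpa using this

/-- The strings of the explicit configuration are the window products of file `…SlidingWindows`: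
`cstr (exM α) q e = swW α 0 1 e q`. -/
theorem cstr_exM (q : ZMod n) (e : ℕ) : cstr (exM α) q e = swW α 0 1 e q := by
  simp [cstr, swW, exM]

/-- `cstr (exM' α) (q+1) e = swW α 0 1 e (q+2)`. -/
theorem cstr_exM' (q : ZMod n) (e : ℕ) : cstr (exM' α) (q + 1) e = swW α 0 1 e (q + 2) := by
  simp only [cstr, swW, exM', exM]
  refine Finset.prod_congr rfl fun s _ => ?_
  rw [show q + 1 + (s : ZMod n) + 1 = q + 2 + (s : ZMod n) by ring]

/-- Right extension of a window product: `swW ρ i₀ i₁ (f+1) q = swW ρ i₀ i₁ f q · (X i₀ - ρ(q+f) X i₁)`. -/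
theorem swW_succ_right {σ : Type*} (ρ : ZMod n → K) (i₀ i₁ : σ) (f : ℕ) (q : ZMod n) :
    swW ρ i₀ i₁ (f + 1) q = swW ρ i₀ i₁ f q * (X i₀ - C (ρ (q + (f : ZMod n))) * X i₁) := by
  simp [swW, Finset.prod_range_succ]

/-- **The weight-`0` component of a continuant is the product of its loops**:
`(kont (exL γ) m m' a L)_0 = swW γ 2 3 L a` whenever `m, m'` have weight `1`. [this crux] -/
theorem bw_whc_kont {m m' : ZMod n → MvPolynomial (Fin 4) K}
    (hm : ∀ r, IsWeightedHomogeneous bw (m r) 1) (hm' : ∀ r, IsWeightedHomogeneous bw (m' r) 1)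
    (a : ZMod n) : ∀ L : ℕ,
    weightedHomogeneousComponent bw 0 (kont (exL γ) m m' a L) = swW γ 2 3 L a := by
  intro L
  induction L using Nat.twoStepInduction with
  | zero =>
    rw [kont_zero]
    simpa [swW] using (isWeightedHomogeneous_one K bw).weightedHomogeneousComponent_same
  | one =>
    rw [kont_one, (bw_exL γ a).weightedHomogeneousComponent_same]
    simp [swW, exL]
  | more L _ ih2 =>
    rw [kont_add_two, map_add, gbr_weightedHomogeneousComponent_mul_eq_mul bw (bw_exL γ _), ih2,
      gbr_weightedHomogeneousComponent_mul_eq_zero_of_lt bw ((hm _).mul (hm' _)) (by norm_num),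
      add_zero, show L + 2 = (L + 1) + 1 from rfl, swW_succ_right γ 2 3 (L + 1) a, mul_comm]
    rfl

/-- Bottom of a clockwise pure product: `(Tw q e)_e = swW α 0 1 e q · swW γ 2 3 (n-1-e) (q+e+1)`. -/
theorem bw_whc_Tw (q : ZMod n) (e : ℕ) :
    weightedHomogeneousComponent bw e (Tw (exL γ) (exM α) (exM' α) q e) =
      swW α 0 1 e q * swW γ 2 3 (n - 1 - e) (q + ((e + 1 : ℕ) : ZMod n)) := by
  unfold Tw
  rw [gbr_weightedHomogeneousComponent_mul_eq_mul bw (bw_cstr (bw_exM α) q e),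
    bw_whc_kont γ (bw_exM α) (bw_exM' α), cstr_exM]

/-- Bottom of a counter-clockwise pure product:
`(Sw q e)_e = swW α 0 1 e (q+2) · swW γ 2 3 (n-1-e) (q+e+1)`. -/
theorem bw_whc_Sw (q : ZMod n) (e : ℕ) :
    weightedHomogeneousComponent bw e (Sw (exL γ) (exM α) (exM' α) q e) =
      swW α 0 1 e (q + 2) * swW γ 2 3 (n - 1 - e) (q + ((e + 1 : ℕ) : ZMod n)) := by
  unfold Sw
  rw [gbr_weightedHomogeneousComponent_mul_eq_mul bw (bw_cstr (bw_exM' α) (q + 1) e),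
    bw_whc_kont γ (bw_exM α) (bw_exM' α), cstr_exM']

/-- `Tw q e` has weight-`d` component `0` for `d < e`. -/
theorem bw_whc_Tw_eq_zero (q : ZMod n) {e d : ℕ} (hd : d < e) :
    weightedHomogeneousComponent bw d (Tw (exL γ) (exM α) (exM' α) q e) = 0 := by
  unfold Tw
  exact gbr_weightedHomogeneousComponent_mul_eq_zero_of_lt bw (bw_cstr (bw_exM α) q e) hd

/-- `Sw q e` has weight-`d` component `0` for `d < e`. -/
theorem bw_whc_Sw_eq_zero (q : ZMod n) {e d : ℕ} (hd : d < e) :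
    weightedHomogeneousComponent bw d (Sw (exL γ) (exM α) (exM' α) q e) = 0 := by
  unfold Sw
  exact gbr_weightedHomogeneousComponent_mul_eq_zero_of_lt bw (bw_cstr (bw_exM' α) (q + 1) e) hd

/-- The pure product selected by `o`: `Tw` (`o = 0`) or `Sw` (`o = 1`); its bottom. -/
theorem bw_whc_TS (q : ZMod n) (e : ℕ) (o : Fin 2) :
    weightedHomogeneousComponent bw e
        (if o = 0 then Tw (exL γ) (exM α) (exM' α) q e else Sw (exL γ) (exM α) (exM' α) q e) =
      swW α 0 1 e (q + 2 * ((o : ℕ) : ZMod n)) * swW γ 2 3 (n - 1 - e) (q + ((e + 1 : ℕ) : ZMod n)) := by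
  fin_cases o
  · simp [bw_whc_Tw]
  · simp [bw_whc_Sw]

/-- The selected pure product has no component of weight `d < e`. -/
theorem bw_whc_TS_eq_zero (q : ZMod n) {e d : ℕ} (hd : d < e) (o : Fin 2) :
    weightedHomogeneousComponent bw d
        (if o = 0 then Tw (exL γ) (exM α) (exM' α) q e else Sw (exL γ) (exM α) (exM' α) q e) = 0 := by
  split_ifs
  · exact bw_whc_Tw_eq_zero α γ q hd
  · exact bw_whc_Sw_eq_zero α γ q hd

/-- A weight-`a` factor shifts components: `(p · r)_{a+d} = p · r_d` for `p` of weight `a`.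
[folklore] -/
theorem bw_whc_mul_shift {p r : MvPolynomial (Fin 4) K} {a d : ℕ} (hp : IsWeightedHomogeneous bw p a) :
    weightedHomogeneousComponent bw (a + d) (p * r) = p * weightedHomogeneousComponent bw d r := by
  classical
  ext mo
  rw [coeff_weightedHomogeneousComponent, coeff_mul, coeff_mul]
  split_ifs with hmo
  · refine Finset.sum_congr rfl fun x hx => ?_
    rw [coeff_weightedHomogeneousComponent]
    by_cases hx1 : coeff x.1 p = 0
    · rw [hx1, zero_mul, zero_mul]
    · have hw1 : Finsupp.weight bw x.1 = a := hp hx1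
      have hsum : x.1 + x.2 = mo := Finset.HasAntidiagonal.mem_antidiagonal.mp hx
      have hw2 : Finsupp.weight bw x.2 = d := by
        have := congrArg (Finsupp.weight bw) hsum
        rw [map_add, hw1, hmo] at this
        omega
      rw [if_pos hw2]
  · symm
    refine Finset.sum_eq_zero fun x hx => ?_
    rw [coeff_weightedHomogeneousComponent]
    by_cases hx1 : coeff x.1 p = 0
    · rw [hx1, zero_mul]
    · have hw1 : Finsupp.weight bw x.1 = a := hp hx1
      have hsum : x.1 + x.2 = mo := Finset.HasAntidiagonal.mem_antidiagonal.mp hx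
      rw [if_neg, mul_zero]
      intro hw2
      apply hmo
      have := congrArg (Finsupp.weight bw) hsum
      rw [map_add, hw1, hw2] at this
      exact this.symm

/-- Below the shifted bottom everything vanishes: for `p` of weight `a` and `r` with no components
below `d`, `(p · r)_{d'} = 0` for `d' < a + d`. [folklore] -/
theorem bw_whc_mul_shift_eq_zero {p r : MvPolynomial (Fin 4) K} {a d d' : ℕ}
    (hp : IsWeightedHomogeneous bw p a)
    (hr : ∀ d'' < d, weightedHomogeneousComponent bw d'' r = 0) (hd' : d' < a + d) :
    weightedHomogeneousComponent bw d' (p * r) = 0 := by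
  classical
  ext mo
  rw [coeff_weightedHomogeneousComponent, coeff_zero]
  split_ifs with hmo
  · rw [coeff_mul]
    refine Finset.sum_eq_zero fun x hx => ?_
    by_cases hx1 : coeff x.1 p = 0
    · rw [hx1, zero_mul]
    · have hw1 : Finsupp.weight bw x.1 = a := hp hx1
      have hsum : x.1 + x.2 = mo := Finset.HasAntidiagonal.mem_antidiagonal.mp hx
      have hw2 : Finsupp.weight bw x.2 < d := by
        have := congrArg (Finsupp.weight bw) hsum
        rw [map_add, hw1, hmo] at this
        omega
      have hz := hr _ hw2
      have : coeff x.2 (weightedHomogeneousComponent bw (Finsupp.weight bw x.2) r) = 0 := by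
        rw [hz, coeff_zero]
      rw [coeff_weightedHomogeneousComponent, if_pos rfl] at this
      rw [this, mul_zero]
  · rfl

/-- **Bottom of a Right-multiplied pure product** = the Right stratum generator. [this crux] -/
theorem bw_whc_genR (e : ℕ) (i : ZMod n × Fin 2 × Fin 2) :
    weightedHomogeneousComponent bw e (genR α γ e i) = srGen α γ e (n - 1 - e) i := by
  unfold genR srGen
  have h := bw_whc_mul_shift (bw_srMul (K := K) i.2.2) (d := e)
    (r := if i.2.1 = 0 then Tw (exL γ) (exM α) (exM' α) i.1 e else Sw (exL γ) (exM α) (exM' α) i.1 e)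
  rw [zero_add] at h
  rw [h, bw_whc_TS]
  ring

/-- A Right-multiplied pure product has no component of weight `d < e`. [this crux] -/
theorem bw_whc_genR_eq_zero {e d : ℕ} (hd : d < e) (i : ZMod n × Fin 2 × Fin 2) :
    weightedHomogeneousComponent bw d (genR α γ e i) = 0 := by
  unfold genR
  exact bw_whc_mul_shift_eq_zero (bw_srMul (K := K) i.2.2)
    (fun d' hd' => bw_whc_TS_eq_zero α γ i.1 hd' i.2.1) (by omega)

/-- **Bottom of a Left-multiplied pure product** = the Left stratum generator. [this crux] -/
theorem bw_whc_genL (e : ℕ) (i : ZMod n × Fin 2 × Fin 2) :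
    weightedHomogeneousComponent bw (e + 1) (genL α γ e i) = slGen α γ e (n - 1 - e) i := by
  unfold genL slGen
  have h := bw_whc_mul_shift (bw_slMul (K := K) i.2.2) (d := e)
    (r := if i.2.1 = 0 then Tw (exL γ) (exM α) (exM' α) i.1 e else Sw (exL γ) (exM α) (exM' α) i.1 e)
  rw [add_comm] at h
  rw [h, bw_whc_TS]
  ring

/-- A Left-multiplied pure product has no component of weight `d < e + 1`. [this crux] -/
theorem bw_whc_genL_eq_zero {e d : ℕ} (hd : d < e + 1) (i : ZMod n × Fin 2 × Fin 2) :
    weightedHomogeneousComponent bw d (genL α γ e i) = 0 := by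
  unfold genL
  exact bw_whc_mul_shift_eq_zero (bw_slMul (K := K) i.2.2)
    (fun d' hd' => bw_whc_TS_eq_zero α γ i.1 hd' i.2.1) (by omega)

end bottoms

end

end Summit.ValiantsHypothesis.ValiantsHypothesis.Theorems.ValuativeFlip
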